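import Summits.AtomisticToContinuum.HydrodynamicLimit.Theorems.TwoClocksEquilibriumFastWindowLDBirthT12StepMoments
import Literature.Analysis.SpecialFunctions.LegendreNikolskii
import Literature.Probability.Distributions.GaussianMoments
import HarnessLib

/-!
# The law of the outgoing (cosine, speed ratio) of ONE true collision step against the Lorentz step, II:
# the whole slice, the physical variables `(S, τ)`, the Gaussian average over the partner projection
# (helpers `t12_stepCos_true_le_lorentz`, `t12_stepMoment_gauss_le` of the line `birth`, crux
# `TwoClocks.EquilibriumFastWindowLD`, stmt-AtomisticToContinuum-14440; §6 of the registered analytic sub-goal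
# `t12_logLinearPreimage_and_dipoleModulus` via slices, step (3): the one-step moment comparison)

Continuation of `…T12StepMoments` (notation `m = 1 - x² + t²`, `ρ = (1 - (x - t) x)/√m`, `t = τ/S`; there: the
Jacobian `J_t = 4m²/|m - t x|` of the true law, `J_t ≤ 4ρ² + 8|t|` on the bulk `m > 4|t|`, the exact Lorentz law
`J_0 = 4ρ²`, and the obstruction at `ρ = 0`, `t < 0`: there `m = (x - t)|t|` and `J_t = 4|t|(x - t)²/(2x + |t|) ≈ 2|t|`). Here:
* the grazing tail `m ≤ 4|t|` has mass `≤ 40 |t|^{3/2} ≤ 20 |t|` (`stepCos_tail_le`) and there is no flux on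
  `[-1, t]`, so (`stepCos_le`) for every measurable `F` with `0 ≤ F`, `F ≤ 1` on `[-1, 1]` and EVERY `t ∈ ℝ`:
  `4 ∫_{-1}^{1} (x - t)₊ √m F(ρ) dx ≤ 4 ∫₀¹ z² F(z) dz + 32 |t| (1 + |t|)²` (crude bound `8 (1 + |t|)²` off `|t| ≤ 1/4`);
* the physical variables (`stepCos_scale`: flux `(S x - τ)₊ = S (x - t)₊`, speed `r = √(S² - (S x)² + τ²) = S √m`,
  cosine `(S - (S x - τ) x)/r = ρ`) give the registered **`t12_stepCos_true_le_lorentz`** (M3''): for `S > 0`, all `τ`,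
  `(4/S) ∫_{-1}^{1} (S x - τ)₊ (r/S) F(ρ) dx ≤ 4 ∫₀¹ z² F + 32 (|τ|/S)(1 + |τ|/S)²`, and (M1, `stepCos_lorentz_phys_eq`)
  equality with `4 ∫₀¹ z² F` at `τ = 0`;
* the weight `(1 + r)/(1 + S) ≤ r/S + 1/(1 + S)` of the `X`-norm `sup |u|/(1 + ‖v‖)`, the flux bound
  `(S x - τ)₊ ≤ S + |τ|`, the envelope `(28 + 100 τ² + 16 τ⁴)/S` (`S ≥ 1`) and the Gaussian moments `∫ τ² dγ = 1`,
  `∫ τ⁴ dγ = 3` give the registered **`t12_stepMoment_gauss_le`**: for `S ≥ 1`,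
  `∫ γ(dτ) (4/S) ∫_{-1}^{1} (S x - τ)₊ ((1 + r)/(1 + S)) F(ρ) dx ≤ 4 ∫₀¹ z² F(z) dz + 176/S`, and with `F = |P_ℓ|`
  (`abs_eval_legendre_le_one`) the one-step kernel numbers of the `k`-fold far-field scheme are `≤ μ_ℓ + 176/S`
  UNIFORMLY in `ℓ` (`stepMoment_legendre_gauss_le`): head and tail of the Legendre series at once.

[folklore] (Carleman 1933; Cercignani–Illner–Pulvirenti 1994 §7.2; Grad 1963 §4; slice route of the line `birth`.)
-/

noncomputable section

open MeasureTheory ProbabilityTheory Real Set Filter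
open scoped ENNReal BigOperators
namespace Summit.AtomisticToContinuum.HydrodynamicLimit.Theorems.ClampedCorrectorBirth
open Literature.Analysis.SpecialFunctions Literature.Probability.Distributions

/-! ### The whole slice: integrability, the grazing tail, assembly -/

/-- The slice integrand `(x-t)₊ √m F(ρ)` is bounded by `(1 + |t|)²` on `[-1, 1]` (`0 ≤ F ≤ 1` on `[-1, 1]`).
[folklore] -/
theorem abs_stepCos_integrand_le {F : ℝ → ℝ} (hF0 : ∀ z, 0 ≤ F z) (hF1 : ∀ z, |z| ≤ 1 → F z ≤ 1)
    (t : ℝ) {x : ℝ} (hx : |x| ≤ 1) :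
    |max (x - t) 0 * (√(1 - x ^ 2 + t ^ 2) * F ((1 - (x - t) * x) / √(1 - x ^ 2 + t ^ 2)))| ≤ (1 + |t|) ^ 2 := by
  have habs := abs_nonneg t
  have hx' := abs_le.1 hx
  have h1 : max (x - t) 0 ≤ 1 + |t| := max_le (by linarith [neg_abs_le t]) (by positivity)
  have h2 : √(1 - x ^ 2 + t ^ 2) ≤ 1 + |t| := by
    rw [sqrt_le_iff]
    refine ⟨by positivity, ?_⟩
    rw [← sq_abs t]
    nlinarith
  have h3 : F ((1 - (x - t) * x) / √(1 - x ^ 2 + t ^ 2)) ≤ 1 := hF1 _ (abs_stepCos_le_one hx t)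
  rw [abs_of_nonneg (mul_nonneg (le_max_right _ _) (mul_nonneg (sqrt_nonneg _) (hF0 _))), sq (1 + |t|)]
  exact mul_le_mul h1 ((mul_le_mul h2 h3 (hF0 _) (by positivity)).trans_eq (mul_one _))
    (mul_nonneg (sqrt_nonneg _) (hF0 _)) (by positivity)

/-- The slice integrand is interval integrable between any two points of `[-1, 1]` (measurable and bounded).
[folklore] -/
theorem intervalIntegrable_stepCos {F : ℝ → ℝ} (hF : Measurable F) (hF0 : ∀ z, 0 ≤ F z)
    (hF1 : ∀ z, |z| ≤ 1 → F z ≤ 1) (t : ℝ) {a b : ℝ} (ha : a ∈ Icc (-1:ℝ) 1) (hb : b ∈ Icc (-1:ℝ) 1) :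
    IntervalIntegrable (fun x : ℝ =>
      max (x - t) 0 * (√(1 - x ^ 2 + t ^ 2) * F ((1 - (x - t) * x) / √(1 - x ^ 2 + t ^ 2)))) volume a b := by
  refine (intervalIntegrable_const (c := (1 + |t|) ^ 2)).mono_fun' (by fun_prop)
    ((ae_restrict_iff' measurableSet_uIoc).2 (Eventually.of_forall fun x hx => ?_))
  dsimp only
  rw [Real.norm_eq_abs]
  refine abs_stepCos_integrand_le hF0 hF1 t (abs_le.2 ?_)
  rcases mem_uIoc.1 hx with h | h
  · exact ⟨by linarith [ha.1, h.1], h.2.trans hb.2⟩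
  · exact ⟨by linarith [hb.1, h.1], h.2.trans ha.2⟩

/-- **The grazing tail** `x ∈ (x₁, 1]`, `x₁ = √(1 + t² - 4|t|)`: there `m ≤ 4|t|`, the outgoing speed ratio
is `√m ≤ 2√|t|`, the window has length `≤ 4|t|`, so `4 ∫_{x₁}^{1} (x-t)₊ √m F(ρ) ≤ 40 |t|^{3/2} ≤ 20 |t|`
(`|t| ≤ 1/4`). [folklore] -/
theorem stepCos_tail_le {F : ℝ → ℝ} (hF : Measurable F) (hF0 : ∀ z, 0 ≤ F z)
    (hF1 : ∀ z, |z| ≤ 1 → F z ≤ 1) {t : ℝ} (ht : |t| ≤ 1 / 4) :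
    4 * ∫ x in √(1 + t ^ 2 - 4 * |t|)..1,
        max (x - t) 0 * (√(1 - x ^ 2 + t ^ 2) * F ((1 - (x - t) * x) / √(1 - x ^ 2 + t ^ 2))) ≤ 20 * |t| := by
  set x₁ : ℝ := √(1 + t ^ 2 - 4 * |t|) with hx₁
  have habs := abs_nonneg t
  have htsq : t ^ 2 = |t| ^ 2 := (sq_abs t).symm
  have hx₁sq : x₁ ^ 2 = 1 + t ^ 2 - 4 * |t| := sq_sqrt (by nlinarith)
  have hx₁0 : 0 ≤ x₁ := sqrt_nonneg _
  have hx₁1 : x₁ ≤ 1 := sqrt_le_one.2 (by nlinarith)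
  have hlen : 1 - x₁ ≤ 4 * |t| := by nlinarith
  have hst : √|t| ≤ 1 / 2 := sqrt_le_iff.2 ⟨by norm_num, by norm_num; exact ht⟩
  have h4 : √(4 * |t|) = 2 * √|t| := by
    rw [sqrt_mul (by norm_num : (0:ℝ) ≤ 4), show (4:ℝ) = 2 ^ 2 by norm_num, sqrt_sq zero_le_two]
  have hpt : ∀ x ∈ Icc x₁ 1, max (x - t) 0 * (√(1 - x ^ 2 + t ^ 2) * F ((1 - (x - t) * x) / √(1 - x ^ 2 + t ^ 2))) ≤
      5 / 4 * (2 * √|t| * 1) := by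
    intro x hx
    have hx0 : 0 ≤ x := hx₁0.trans hx.1
    have hxabs : |x| ≤ 1 := abs_le.2 ⟨by linarith, hx.2⟩
    have h1 : max (x - t) 0 ≤ 5 / 4 := max_le (by linarith [neg_abs_le t, hx.2]) (by norm_num)
    have h2 : √(1 - x ^ 2 + t ^ 2) ≤ 2 * √|t| := by
      rw [← h4]
      refine sqrt_le_sqrt ?_
      nlinarith [mul_le_mul hx.1 hx.1 hx₁0 hx0]
    have h3 : F ((1 - (x - t) * x) / √(1 - x ^ 2 + t ^ 2)) ≤ 1 := hF1 _ (abs_stepCos_le_one hxabs t)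
    exact mul_le_mul h1 (mul_le_mul h2 h3 (hF0 _) (by positivity)) (mul_nonneg (sqrt_nonneg _) (hF0 _))
      (by norm_num)
  have hmono := intervalIntegral.integral_mono_on hx₁1
    (intervalIntegrable_stepCos hF hF0 hF1 t ⟨by linarith, hx₁1⟩ ⟨by norm_num, le_rfl⟩)
    intervalIntegrable_const hpt
  rw [intervalIntegral.integral_const, smul_eq_mul] at hmono
  calc 4 * ∫ x in x₁..1, max (x - t) 0 * (√(1 - x ^ 2 + t ^ 2) * F ((1 - (x - t) * x) / √(1 - x ^ 2 + t ^ 2)))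
      ≤ 4 * ((1 - x₁) * (5 / 4 * (2 * √|t| * 1))) := by linarith
    _ = 10 * ((1 - x₁) * √|t|) := by ring
    _ ≤ 10 * (4 * |t| * (1 / 2)) := by gcongr
    _ = 20 * |t| := by ring

/-- **One true slice against the Lorentz law, `|t| ≤ 1/4`**: for measurable `F` with `0 ≤ F`, `F ≤ 1` on
`[-1, 1]`, `4 ∫_{-1}^{1} (x-t)₊ √m F(ρ) dx ≤ 4 ∫₀¹ z² F(z) dz + 28 |t|` (no flux on `[-1, t]`, the bulk
`(t, x₁)` by the Jacobian comparison, the grazing tail `(x₁, 1]`). [folklore] -/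
theorem stepCos_le_of_abs_le {F : ℝ → ℝ} (hF : Measurable F) (hF0 : ∀ z, 0 ≤ F z)
    (hF1 : ∀ z, |z| ≤ 1 → F z ≤ 1) {t : ℝ} (ht : |t| ≤ 1 / 4) :
    4 * ∫ x in (-1:ℝ)..1, max (x - t) 0 * (√(1 - x ^ 2 + t ^ 2) * F ((1 - (x - t) * x) / √(1 - x ^ 2 + t ^ 2))) ≤
      (4 * ∫ z in (0:ℝ)..1, z ^ 2 * F z) + 28 * |t| := by
  set x₁ : ℝ := √(1 + t ^ 2 - 4 * |t|) with hx₁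
  have habs := abs_nonneg t
  have htsq : t ^ 2 = |t| ^ 2 := (sq_abs t).symm
  have hx₁1 : x₁ ≤ 1 := sqrt_le_one.2 (by nlinarith)
  have htx₁ : |t| ≤ x₁ := abs_le_sqrt (by nlinarith)
  have ht1 : t ∈ Icc (-1:ℝ) 1 := ⟨by linarith [neg_abs_le t], by linarith [le_abs_self t]⟩
  have htx₁' : t ≤ x₁ := (le_abs_self t).trans htx₁
  have hx₁I : x₁ ∈ Icc (-1:ℝ) 1 := ⟨by linarith [ht1.1], hx₁1⟩
  have hI := fun (a b : ℝ) (ha : a ∈ Icc (-1:ℝ) 1) (hb : b ∈ Icc (-1:ℝ) 1) =>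
    intervalIntegrable_stepCos hF hF0 hF1 t ha hb
  have hm1 : (-1:ℝ) ∈ Icc (-1:ℝ) 1 := ⟨le_rfl, by norm_num⟩
  have hp1 : (1:ℝ) ∈ Icc (-1:ℝ) 1 := ⟨by norm_num, le_rfl⟩
  rw [← intervalIntegral.integral_add_adjacent_intervals (hI _ _ hm1 ht1) (hI _ _ ht1 hp1),
    ← intervalIntegral.integral_add_adjacent_intervals (hI _ _ ht1 hx₁I) (hI _ _ hx₁I hp1)]
  -- no flux on `[-1, t]`
  have h0 : ∫ x in (-1:ℝ)..t, max (x - t) 0 * (√(1 - x ^ 2 + t ^ 2) * F ((1 - (x - t) * x) / √(1 - x ^ 2 + t ^ 2))) = 0 := by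
    have : ∫ x in (-1:ℝ)..t, max (x - t) 0 * (√(1 - x ^ 2 + t ^ 2) * F ((1 - (x - t) * x) / √(1 - x ^ 2 + t ^ 2))) =
        ∫ x in (-1:ℝ)..t, (0:ℝ) := by
      refine intervalIntegral.integral_congr fun x hx => ?_
      rw [uIcc_of_le ht1.1] at hx
      rw [max_eq_right (sub_nonpos.2 hx.2), zero_mul]
    rw [this, intervalIntegral.integral_zero]
  -- the bulk
  have hB : 4 * ∫ x in t..x₁, max (x - t) 0 * (√(1 - x ^ 2 + t ^ 2) * F ((1 - (x - t) * x) / √(1 - x ^ 2 + t ^ 2))) ≤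
      (4 * ∫ z in (0:ℝ)..1, z ^ 2 * F z) + 8 * |t| := by
    rw [intervalIntegral.integral_of_le htx₁', integral_Ioc_eq_integral_Ioo, ← integral_const_mul]
    exact stepCos_bulk_le hF hF0 hF1 ht
  have hT := stepCos_tail_le hF hF0 hF1 ht
  rw [h0, zero_add, mul_add]
  linarith

/-- **The crude bound** (all `t`): `4 ∫_{-1}^{1} (x-t)₊ √m F(ρ) dx ≤ 8 (1 + |t|)²`. [folklore] -/
theorem stepCos_le_crude {F : ℝ → ℝ} (hF : Measurable F) (hF0 : ∀ z, 0 ≤ F z)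
    (hF1 : ∀ z, |z| ≤ 1 → F z ≤ 1) (t : ℝ) :
    4 * ∫ x in (-1:ℝ)..1, max (x - t) 0 * (√(1 - x ^ 2 + t ^ 2) * F ((1 - (x - t) * x) / √(1 - x ^ 2 + t ^ 2))) ≤
      8 * (1 + |t|) ^ 2 := by
  have hmono := intervalIntegral.integral_mono_on (by norm_num : (-1:ℝ) ≤ 1)
    (intervalIntegrable_stepCos hF hF0 hF1 t ⟨le_rfl, by norm_num⟩ ⟨by norm_num, le_rfl⟩)
    (intervalIntegrable_const (c := (1 + |t|) ^ 2))
    (fun x hx => (le_abs_self _).trans (abs_stepCos_integrand_le hF0 hF1 t (abs_le.2 ⟨hx.1, hx.2⟩)))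
  rw [intervalIntegral.integral_const, smul_eq_mul] at hmono
  linarith

/-- **One true slice against the Lorentz law, all `t`**: for measurable `F` with `0 ≤ F`, `F ≤ 1` on `[-1, 1]`,

  `4 ∫_{-1}^{1} (x-t)₊ √(1 - x² + t²) F((1 - (x-t)x)/√(1 - x² + t²)) dx ≤ 4 ∫₀¹ z² F(z) dz + 32 |t| (1 + |t|)²`

— with `t = τ/S` this is the flux-normalised law of the outgoing cosine `ρ`, weighted by the speed ratio `r/S`,
of the own particle at speed `S` hit with Gaussian partner projection `τ`, against the Lorentz law `4ρ² dρ`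
(`t = 0`, where equality holds: `t12_stepCos_lorentz_eq`); the additive form is forced (the true law charges
`ρ ≈ 0` with density `≈ 2 t₋`, the Lorentz density `4ρ²` vanishes there). [folklore] -/
theorem stepCos_le {F : ℝ → ℝ} (hF : Measurable F) (hF0 : ∀ z, 0 ≤ F z)
    (hF1 : ∀ z, |z| ≤ 1 → F z ≤ 1) (t : ℝ) :
    4 * ∫ x in (-1:ℝ)..1, max (x - t) 0 * (√(1 - x ^ 2 + t ^ 2) * F ((1 - (x - t) * x) / √(1 - x ^ 2 + t ^ 2))) ≤
      (4 * ∫ z in (0:ℝ)..1, z ^ 2 * F z) + 32 * |t| * (1 + |t|) ^ 2 := by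
  have habs := abs_nonneg t
  rcases le_or_gt |t| (1 / 4) with ht | ht
  · have h := stepCos_le_of_abs_le hF hF0 hF1 ht
    have h1 : (1:ℝ) ≤ (1 + |t|) ^ 2 := by nlinarith
    have h2 : 32 * |t| * 1 ≤ 32 * |t| * (1 + |t|) ^ 2 := mul_le_mul_of_nonneg_left h1 (by positivity)
    linarith
  · have h := stepCos_le_crude hF hF0 hF1 t
    have h0 : 0 ≤ 4 * ∫ z in (0:ℝ)..1, z ^ 2 * F z :=
      mul_nonneg (by norm_num) (intervalIntegral.integral_nonneg zero_le_one fun z _ =>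
        mul_nonneg (sq_nonneg z) (hF0 z))
    have h2 : 8 * (1 + |t|) ^ 2 ≤ 32 * |t| * (1 + |t|) ^ 2 :=
      mul_le_mul_of_nonneg_right (by linarith) (sq_nonneg _)
    linarith

/-! ### Back to the physical variables: speed `S`, partner projection `τ`, `t = τ/S` -/

/-- **Scaling**: at speed `S > 0` and partner projection `τ`, with `t = τ/S`, the flux `(S x - τ)₊`, the
outgoing speed `r = √(S² - (S x)² + τ²) = S √(1 - x² + t²)` and the outgoing cosine
`ρ = (S - (S x - τ) x)/r = (1 - (x - t) x)/√(1 - x² + t²)`: the physical slice integrand with the speed-ratio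
weight `r/S` is `S` times the normalised one. [folklore] -/
theorem stepCos_scale (F : ℝ → ℝ) {S : ℝ} (hS : 0 < S) (τ x : ℝ) :
    max (S * x - τ) 0 * (√(S ^ 2 - (S * x) ^ 2 + τ ^ 2) / S *
      F ((S - (S * x - τ) * x) / √(S ^ 2 - (S * x) ^ 2 + τ ^ 2))) =
      S * (max (x - τ / S) 0 * (√(1 - x ^ 2 + (τ / S) ^ 2) *
        F ((1 - (x - τ / S) * x) / √(1 - x ^ 2 + (τ / S) ^ 2)))) := by
  have hS0 := hS.le
  have h1 : S * x - τ = S * (x - τ / S) := by field_simp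
  have h2 : √(S ^ 2 - (S * x) ^ 2 + τ ^ 2) = S * √(1 - x ^ 2 + (τ / S) ^ 2) := by
    rw [show S ^ 2 - (S * x) ^ 2 + τ ^ 2 = S ^ 2 * (1 - x ^ 2 + (τ / S) ^ 2) by field_simp,
      sqrt_mul (sq_nonneg S), sqrt_sq hS0]
  have h3 : S - (S * x - τ) * x = S * (1 - (x - τ / S) * x) := by field_simp
  have hmax : max (S * (x - τ / S)) 0 = S * max (x - τ / S) 0 := by rw [mul_max_of_nonneg _ _ hS0, mul_zero]
  rw [h3, h1, h2, hmax, mul_div_mul_left _ _ hS.ne', mul_div_cancel_left₀ _ hS.ne']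
  ring

/-- The outgoing cosine is a cosine: `|(S - (S x - τ) x)/√(S² - (S x)² + τ²)| ≤ 1` for `|x| ≤ 1`, `S > 0`.
[folklore] -/
theorem abs_stepCos_phys_le_one {S : ℝ} (hS : 0 < S) (τ : ℝ) {x : ℝ} (hx : |x| ≤ 1) :
    |(S - (S * x - τ) * x) / √(S ^ 2 - (S * x) ^ 2 + τ ^ 2)| ≤ 1 := by
  have h2 : √(S ^ 2 - (S * x) ^ 2 + τ ^ 2) = S * √(1 - x ^ 2 + (τ / S) ^ 2) := by
    rw [show S ^ 2 - (S * x) ^ 2 + τ ^ 2 = S ^ 2 * (1 - x ^ 2 + (τ / S) ^ 2) by field_simp,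
      sqrt_mul (sq_nonneg S), sqrt_sq hS.le]
  have h3 : S - (S * x - τ) * x = S * (1 - (x - τ / S) * x) := by field_simp
  rw [h2, h3, mul_div_mul_left _ _ hS.ne']
  exact abs_stepCos_le_one hx _

/-- **(M3'') The one-step law of (cosine, speed ratio) of a TRUE collision step is dominated by the Lorentz
law, pointwise in the partner projection.** For measurable `F : ℝ → ℝ` with `0 ≤ F` and `F ≤ 1` on `[-1, 1]`,
every speed `S > 0` and every partner projection `τ ∈ ℝ`:

  `(4/S) ∫_{-1}^{1} (S x - τ)₊ · (r/S) · F(ρ) dx ≤ 4 ∫₀¹ z² F(z) dz + 32 (|τ|/S) (1 + |τ|/S)²`,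

`r = √(S² - (S x)² + τ²)` the outgoing speed and `ρ = (S - (S x - τ) x)/r` the outgoing cosine of the own
particle `v' = v - (S x - τ) ω` (`x = ⟪v̂, ω⟫`, `τ = ⟪w, ω⟫ ∼ γ` under the Maxwellian): the flux-normalised
(`ν ≥ πS`, azimuth integrated) one-step kernel number of the `k`-fold far-field scheme with the speed-ratio weight,
against its Lorentz value `4 ∫₀¹ z² F` (`τ = 0`). With `F = |P_ℓ|` the right side is `μ_ℓ + O(|τ|/S)` UNIFORMLY
in `ℓ` (no Markov/Lipschitz constant of `P_ℓ`): step (3) of the slice route. Registered helper. [folklore] -/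
theorem t12_stepCos_true_le_lorentz : ∀ (F : ℝ → ℝ), Measurable F → (∀ z : ℝ, 0 ≤ F z) → (∀ z : ℝ, |z| ≤ 1 → F z ≤ 1) → ∀ S τ : ℝ, 0 < S → 4 / S * ∫ x in (-1:ℝ)..1, max (S * x - τ) 0 * (Real.sqrt (S ^ 2 - (S * x) ^ 2 + τ ^ 2) / S * F ((S - (S * x - τ) * x) / Real.sqrt (S ^ 2 - (S * x) ^ 2 + τ ^ 2))) ≤ (4 * ∫ z in (0:ℝ)..1, z ^ 2 * F z) + 32 * (|τ| / S) * (1 + |τ| / S) ^ 2 := by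
  intro F hF hF0 hF1 S τ hS
  have h := stepCos_le hF hF0 hF1 (τ / S)
  rw [abs_div, abs_of_pos hS] at h
  simp_rw [stepCos_scale F hS τ]
  rwa [intervalIntegral.integral_const_mul, ← mul_assoc, div_mul_cancel₀ _ hS.ne']

/-- **(M1) in the physical variables**: the Lorentz slice (`τ = 0`) with the speed-ratio weight is EXACTLY
`4 ∫₀¹ z² F(z) dz` (every `F`, every `S > 0`); with `F = |P_ℓ|` this is `μ_ℓ` of `…T12Legendre`. [folklore] -/
theorem stepCos_lorentz_phys_eq (F : ℝ → ℝ) {S : ℝ} (hS : 0 < S) :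
    4 / S * ∫ x in (-1:ℝ)..1, max (S * x) 0 * (√(S ^ 2 - (S * x) ^ 2) / S *
      F ((S - S * x * x) / √(S ^ 2 - (S * x) ^ 2))) = 4 * ∫ z in (0:ℝ)..1, z ^ 2 * F z := by
  have h := fun x => stepCos_scale F hS 0 x
  simp only [sub_zero, zero_div, ne_eq, OfNat.ofNat_ne_zero, not_false_eq_true, zero_pow, add_zero] at h
  simp_rw [h]
  rw [intervalIntegral.integral_const_mul, ← mul_assoc, div_mul_cancel₀ _ hS.ne']
  exact t12_stepCos_lorentz_eq F

/-! ### The weight `(1 + r)/(1 + S)` of the `X`-norm and the Gaussian average over `τ` -/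

/-- The polynomial envelope of the error after the Gaussian projection, `S ≥ 1`:
`32 (|τ|/S)(1 + |τ|/S)² + 8 (1 + |τ|)/S ≤ (28 + 100 τ² + 16 τ⁴)/S`. [folklore] -/
theorem stepCos_envelope_le {S : ℝ} (hS : 1 ≤ S) (τ : ℝ) :
    32 * (|τ| / S) * (1 + |τ| / S) ^ 2 + 8 * (1 + |τ|) / S ≤ (28 + 100 * τ ^ 2 + 16 * τ ^ 4) / S := by
  have hS0 : 0 < S := by linarith
  have ha := abs_nonneg τ
  have h1 : |τ| / S ≤ |τ| := div_le_self ha hS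
  have h2 : 32 * (|τ| / S) * (1 + |τ| / S) ^ 2 ≤ 32 * (|τ| / S) * (1 + |τ|) ^ 2 := by gcongr
  have h3 : 32 * |τ| * (1 + |τ|) ^ 2 + 8 * (1 + |τ|) ≤ 28 + 100 * τ ^ 2 + 16 * τ ^ 4 := by
    have e2 : τ ^ 2 = |τ| ^ 2 := (sq_abs τ).symm
    have e4 : τ ^ 4 = |τ| ^ 4 := by rw [show τ ^ 4 = (τ ^ 2) ^ 2 by ring, e2]; ring
    rw [e2, e4]
    nlinarith [sq_nonneg (1 - |τ|), mul_nonneg (sq_nonneg (1 - |τ|)) (sq_nonneg |τ|),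
      mul_nonneg (sq_nonneg (1 - |τ|)) ha]
  calc 32 * (|τ| / S) * (1 + |τ| / S) ^ 2 + 8 * (1 + |τ|) / S
      ≤ 32 * (|τ| / S) * (1 + |τ|) ^ 2 + 8 * (1 + |τ|) / S := by linarith
    _ = (32 * |τ| * (1 + |τ|) ^ 2 + 8 * (1 + |τ|)) / S := by ring
    _ ≤ (28 + 100 * τ ^ 2 + 16 * τ ^ 4) / S := div_le_div_of_nonneg_right h3 hS0.le

/-- The Gaussian moments of the envelope: `∫ (28 + 100 τ² + 16 τ⁴) dγ = 176` (`∫ τ² dγ = 1`, `∫ τ⁴ dγ = 3`),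
with integrability. [folklore] -/
theorem integral_stepCos_envelope :
    Integrable (fun τ : ℝ => 28 + 100 * τ ^ 2 + 16 * τ ^ 4) (gaussianReal 0 1) ∧
      ∫ τ, (28 + 100 * τ ^ 2 + 16 * τ ^ 4) ∂gaussianReal 0 1 = 176 := by
  have i2 : Integrable (fun t : ℝ => t ^ 2) (gaussianReal 0 1) := integrable_pow_gaussianReal 0 1 2
  have i4 : Integrable (fun t : ℝ => t ^ 4) (gaussianReal 0 1) := integrable_pow_gaussianReal 0 1 4
  have v2 : ∫ t : ℝ, t ^ 2 ∂gaussianReal 0 1 = 1 := by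
    have h := integral_pow_even_gaussianReal_one 1
    norm_num [Nat.doubleFactorial] at h
    exact h
  have v4 : ∫ t : ℝ, t ^ 4 ∂gaussianReal 0 1 = 3 := by
    have h := integral_pow_even_gaussianReal_one 2
    norm_num [Nat.doubleFactorial] at h
    exact h
  have ia : Integrable (fun t : ℝ => 28 + 100 * t ^ 2) (gaussianReal 0 1) := (integrable_const _).add (i2.const_mul _)
  refine ⟨ia.add (i4.const_mul _), ?_⟩
  rw [integral_add ia (i4.const_mul _), integral_add (integrable_const _) (i2.const_mul _), integral_const_mul,
    integral_const_mul, integral_const, v2, v4, probReal_univ, one_smul]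
  norm_num

/-- **(M3'') averaged over the Gaussian partner projection, with the weight `(1 + r)/(1 + S)` of the `X`-norm
`sup |u|/(1 + ‖v‖)`.** For measurable `F` with `0 ≤ F`, `F ≤ 1` on `[-1, 1]` and every speed `S ≥ 1`:

  `∫ γ(dτ) (4/S) ∫_{-1}^{1} (S x - τ)₊ · (1 + r)/(1 + S) · F(ρ) dx ≤ 4 ∫₀¹ z² F(z) dz + 176/S`

(`r`, `ρ` as in `t12_stepCos_true_le_lorentz`; `(1 + r)/(1 + S) ≤ r/S + 1/(1 + S)`, the flux mass
`∫_{-1}^{1} (S x - τ)₊ ≤ 2(S + |τ|)`, and the Gaussian moments `∫ τ² dγ = 1`, `∫ τ⁴ dγ = 3` of the envelope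
`28 + 100 τ² + 16 τ⁴`). With `F = |P_ℓ|`: the true one-step kernel number of the `k`-fold far-field scheme is
`≤ μ_ℓ + 176/S` uniformly in `ℓ` — the Markov-chain moment comparison, step (3) of the slice route to §6 of
`t12_logLinearPreimage_and_dipoleModulus`; no measurability in `τ` is needed (the left side is a Bochner
integral of a nonnegative function). Registered helper. [folklore] -/
theorem t12_stepMoment_gauss_le : ∀ (F : ℝ → ℝ), Measurable F → (∀ z : ℝ, 0 ≤ F z) → (∀ z : ℝ, |z| ≤ 1 → F z ≤ 1) → ∀ S : ℝ, 1 ≤ S → ∫ τ, (4 / S * ∫ x in (-1:ℝ)..1, max (S * x - τ) 0 * ((1 + Real.sqrt (S ^ 2 - (S * x) ^ 2 + τ ^ 2)) / (1 + S) * F ((S - (S * x - τ) * x) / Real.sqrt (S ^ 2 - (S * x) ^ 2 + τ ^ 2)))) ∂ProbabilityTheory.gaussianReal 0 1 ≤ (4 * ∫ z in (0:ℝ)..1, z ^ 2 * F z) + 176 / S := by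
  intro F hF hF0 hF1 S hS1
  have hS : 0 < S := by linarith
  obtain ⟨ienv, venv⟩ := integral_stepCos_envelope
  -- pointwise in `τ`
  have hpt : ∀ τ : ℝ, 4 / S * ∫ x in (-1:ℝ)..1, max (S * x - τ) 0 * ((1 + √(S ^ 2 - (S * x) ^ 2 + τ ^ 2)) / (1 + S) *
      F ((S - (S * x - τ) * x) / √(S ^ 2 - (S * x) ^ 2 + τ ^ 2))) ≤
      (4 * ∫ z in (0:ℝ)..1, z ^ 2 * F z) + (28 + 100 * τ ^ 2 + 16 * τ ^ 4) / S := by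
    intro τ
    have hmain := t12_stepCos_true_le_lorentz F hF hF0 hF1 S τ hS
    have henv := stepCos_envelope_le hS1 τ
    -- the integrable majorant `g + c` on `(-1, 1]`
    set c : ℝ := (S + |τ|) / (1 + S) with hc
    have hc1 : c ≤ 1 + |τ| := by
      rw [hc, div_le_iff₀ (by positivity)]
      nlinarith [abs_nonneg τ]
    have hgI0 : IntervalIntegrable (fun x : ℝ => max (S * x - τ) 0 * (√(S ^ 2 - (S * x) ^ 2 + τ ^ 2) / S *
        F ((S - (S * x - τ) * x) / √(S ^ 2 - (S * x) ^ 2 + τ ^ 2)))) volume (-1) 1 := by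
      simp_rw [stepCos_scale F hS τ]
      exact (intervalIntegrable_stepCos hF hF0 hF1 (τ / S) ⟨le_rfl, by norm_num⟩ ⟨by norm_num, le_rfl⟩).const_mul S
    have hgI := hgI0.add (intervalIntegrable_const (c := c))
    have hdom : ∀ x ∈ Ioc (-1:ℝ) 1, max (S * x - τ) 0 * ((1 + √(S ^ 2 - (S * x) ^ 2 + τ ^ 2)) / (1 + S) *
        F ((S - (S * x - τ) * x) / √(S ^ 2 - (S * x) ^ 2 + τ ^ 2))) ≤
        max (S * x - τ) 0 * (√(S ^ 2 - (S * x) ^ 2 + τ ^ 2) / S *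
          F ((S - (S * x - τ) * x) / √(S ^ 2 - (S * x) ^ 2 + τ ^ 2))) + c := by
      intro x hx
      have hxabs : |x| ≤ 1 := abs_le.2 ⟨hx.1.le, hx.2⟩
      have hFρ1 : F ((S - (S * x - τ) * x) / √(S ^ 2 - (S * x) ^ 2 + τ ^ 2)) ≤ 1 :=
        hF1 _ (abs_stepCos_phys_le_one hS τ hxabs)
      set r : ℝ := √(S ^ 2 - (S * x) ^ 2 + τ ^ 2) with hr
      have hr0 : 0 ≤ r := sqrt_nonneg _
      have hFρ0 := hF0 ((S - (S * x - τ) * x) / r)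
      have hw : (1 + r) / (1 + S) ≤ r / S + 1 / (1 + S) := by
        rw [div_add_div _ _ hS.ne' (by positivity), div_le_div_iff₀ (by positivity) (by positivity)]
        nlinarith
      have hflux : max (S * x - τ) 0 ≤ S + |τ| :=
        max_le (by nlinarith [(abs_le.1 hxabs).2, neg_abs_le τ]) (by positivity)
      calc max (S * x - τ) 0 * ((1 + r) / (1 + S) * F ((S - (S * x - τ) * x) / r))
          ≤ max (S * x - τ) 0 * ((r / S + 1 / (1 + S)) * F ((S - (S * x - τ) * x) / r)) := by gcongr
        _ = max (S * x - τ) 0 * (r / S * F ((S - (S * x - τ) * x) / r)) +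
              max (S * x - τ) 0 * F ((S - (S * x - τ) * x) / r) / (1 + S) := by ring
        _ ≤ max (S * x - τ) 0 * (r / S * F ((S - (S * x - τ) * x) / r)) + (S + |τ|) * 1 / (1 + S) := by
              gcongr
        _ = _ := by rw [mul_one]
    have h11 : (-1:ℝ) ≤ 1 := by norm_num
    have hstep : ∫ x in (-1:ℝ)..1, max (S * x - τ) 0 * ((1 + √(S ^ 2 - (S * x) ^ 2 + τ ^ 2)) / (1 + S) *
        F ((S - (S * x - τ) * x) / √(S ^ 2 - (S * x) ^ 2 + τ ^ 2))) ≤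
        (∫ x in (-1:ℝ)..1, max (S * x - τ) 0 * (√(S ^ 2 - (S * x) ^ 2 + τ ^ 2) / S *
          F ((S - (S * x - τ) * x) / √(S ^ 2 - (S * x) ^ 2 + τ ^ 2)))) + 2 * c := by
      rw [show 2 * c = ∫ _ in (-1:ℝ)..1, c by rw [intervalIntegral.integral_const, smul_eq_mul]; norm_num,
        ← intervalIntegral.integral_add hgI0 intervalIntegrable_const, intervalIntegral.integral_of_le h11,
        intervalIntegral.integral_of_le h11]
      exact integral_mono_of_nonneg (ae_restrict_of_forall_mem measurableSet_Ioc fun x _ =>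
        mul_nonneg (le_max_right _ _) (mul_nonneg (by positivity) (hF0 _))) hgI.1
        (ae_restrict_of_forall_mem measurableSet_Ioc hdom)
    calc 4 / S * ∫ x in (-1:ℝ)..1, max (S * x - τ) 0 * ((1 + √(S ^ 2 - (S * x) ^ 2 + τ ^ 2)) / (1 + S) *
          F ((S - (S * x - τ) * x) / √(S ^ 2 - (S * x) ^ 2 + τ ^ 2)))
        ≤ 4 / S * ((∫ x in (-1:ℝ)..1, max (S * x - τ) 0 * (√(S ^ 2 - (S * x) ^ 2 + τ ^ 2) / S *
            F ((S - (S * x - τ) * x) / √(S ^ 2 - (S * x) ^ 2 + τ ^ 2)))) + 2 * c) := by gcongr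
      _ = 4 / S * (∫ x in (-1:ℝ)..1, max (S * x - τ) 0 * (√(S ^ 2 - (S * x) ^ 2 + τ ^ 2) / S *
            F ((S - (S * x - τ) * x) / √(S ^ 2 - (S * x) ^ 2 + τ ^ 2)))) + 8 * c / S := by ring
      _ ≤ (4 * ∫ z in (0:ℝ)..1, z ^ 2 * F z) + 32 * (|τ| / S) * (1 + |τ| / S) ^ 2 + 8 * (1 + |τ|) / S := by
          gcongr
      _ ≤ (4 * ∫ z in (0:ℝ)..1, z ^ 2 * F z) + (28 + 100 * τ ^ 2 + 16 * τ ^ 4) / S := by linarith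
  -- the Gaussian average
  have hnn : ∀ τ : ℝ, 0 ≤ 4 / S * ∫ x in (-1:ℝ)..1, max (S * x - τ) 0 * ((1 + √(S ^ 2 - (S * x) ^ 2 + τ ^ 2)) / (1 + S) *
      F ((S - (S * x - τ) * x) / √(S ^ 2 - (S * x) ^ 2 + τ ^ 2))) := fun τ =>
    mul_nonneg (by positivity) (intervalIntegral.integral_nonneg (by norm_num) fun x _ =>
      mul_nonneg (le_max_right _ _) (mul_nonneg (by positivity) (hF0 _)))
  have hupI : Integrable (fun τ : ℝ => (4 * ∫ z in (0:ℝ)..1, z ^ 2 * F z) + (28 + 100 * τ ^ 2 + 16 * τ ^ 4) / S)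
      (gaussianReal 0 1) := (integrable_const _).add (ienv.div_const S)
  calc ∫ τ, (4 / S * ∫ x in (-1:ℝ)..1, max (S * x - τ) 0 * ((1 + √(S ^ 2 - (S * x) ^ 2 + τ ^ 2)) / (1 + S) *
        F ((S - (S * x - τ) * x) / √(S ^ 2 - (S * x) ^ 2 + τ ^ 2)))) ∂gaussianReal 0 1
      ≤ ∫ τ, ((4 * ∫ z in (0:ℝ)..1, z ^ 2 * F z) + (28 + 100 * τ ^ 2 + 16 * τ ^ 4) / S) ∂gaussianReal 0 1 :=
        integral_mono_of_nonneg (ae_of_all _ hnn) hupI (ae_of_all _ hpt)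
    _ = (4 * ∫ z in (0:ℝ)..1, z ^ 2 * F z) + 176 / S := by
        rw [integral_add (integrable_const _) (ienv.div_const S), integral_const, probReal_univ, one_smul,
          integral_div, venv]

/-- **The one-step kernel numbers of the far-field scheme**: for every `ℓ` and every speed `S ≥ 1`, the Gaussian
average of the flux-normalised true step with the angular factor `|P_ℓ(ρ)|` and the weight `(1 + r)/(1 + S)` is at
most `μ_ℓ + 176/S`, `μ_ℓ = 4 ∫₀¹ z² |P_ℓ(z)| dz` the Lorentz number of `…T12Legendre` (`|P_ℓ| ≤ 1` on `[-1, 1]`).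
[folklore] -/
theorem stepMoment_legendre_gauss_le (ℓ : ℕ) {S : ℝ} (hS : 1 ≤ S) :
    ∫ τ, (4 / S * ∫ x in (-1:ℝ)..1, max (S * x - τ) 0 * ((1 + √(S ^ 2 - (S * x) ^ 2 + τ ^ 2)) / (1 + S) *
      |(legendre ℓ).eval ((S - (S * x - τ) * x) / √(S ^ 2 - (S * x) ^ 2 + τ ^ 2))|)) ∂gaussianReal 0 1 ≤
      (4 * ∫ z in (0:ℝ)..1, z ^ 2 * |(legendre ℓ).eval z|) + 176 / S :=
  t12_stepMoment_gauss_le (fun z => |(legendre ℓ).eval z|)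
    (continuous_abs.comp (legendre ℓ).continuous).measurable (fun _ => abs_nonneg _)
    (fun _ hz => abs_eval_legendre_le_one ℓ hz) S hS

end Summit.AtomisticToContinuum.HydrodynamicLimit.Theorems.ClampedCorrectorBirth
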